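/-
Copyright (c) 2026 the pub-hodgecm-mathlib formalisation cell (harness21).  Prover seat hodgecm-mathlib-A-p12 (g21), 2026-09-01.  Road «S3-tree» (architect A-p16 (g29)), brick T3′
«depth-zero κ-transfer», row (P-1) LAST MILE «the Cayley shift of a Flicker literal is a Flicker literal of the same type at the exponents lowered by one»
(T3′ holder F0P3b-p01 (g12)'s census row (i)): the generic algebra — shift-by-one orders, the unitary eigenframe, and the `Valued` scalar package.
-/
import Literature.NumberTheory.Automorphic.SplitTorusOrderCayleyShift      -- ★ p845616 CAYLEY (F0P3b-p01 (g11)): `span_pow_*`, `cayley_sub_cayley`, `map_cayley_mul_cayley`, …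
import Literature.NumberTheory.Automorphic.UnitaryGroupAutomorphicRep       -- ★ `unitaryGroupOfForm`, `mem_unitaryGroupOfForm_iff`
import Mathlib.Topology.Algebra.Valued.ValuationTopology
import HarnessLib

/-!
# The Cayley shift, continued: shift-by-one orders, the unitary eigenframe `P·diag(Y)·P⁻¹ ∈ U(σ, Φ)`, and the `Valued` scalar package

Topic `NumberTheory/Automorphic`; namespace `Literature.NumberTheory.Automorphic`.  THEOREMS ONLY (no definition, no instance, no notation, no named fact,
no `sorry`).  Cell `pub/hodgecm-mathlib` (D-0151), crux H413 = `stmt-HodgeConjecture-24833`; road «S3-tree», brick T3′ «depth-zero κ-transfer», assembly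
row (P-1) (holder F0P3b-p01 (g12)), its LAST MILE: the residually-trivial fixed-coset count `n₀(t)` of a Flicker literal `t = t_π(x₁,x₂,x₃)` ∕ `t_1(x₁,x₂,x₃)`
(★ `ResiduallyTrivialFixedCosetCountCayley`: `n₀(t) = #Fix(Y)`) is the unit fixed-point count of its CAYLEY SHIFT `Y = P·diag(Y₁,Y₂,Y₃)·P⁻¹`,
`Y_i = (1 + Z_i)(1 − Z_i)⁻¹`, `Z_i = ϖ⁻¹(x_i − 1)(x_i + 1)⁻¹` — a literal OF THE SAME TYPE (same eigenframe `P`) whose root exponents are those of `t`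
lowered by one.  This file supplies the three generic ingredients the CM-place statement (★ `DepthZeroKappaTransferTypeOneRowZero`) consumes:

* §1 `one_add_mem_span_pow`, **`span_pow_one_add_eq`**: `span_O {(1 + u)^j} = span_O {u^j}` (`u_i ∈ O`) — the shifted element `X = 1 + ϖ⁻¹(x − 1)` of ★
  ORDER-STABILITY and the shift `ϖ⁻¹(x − 1)` of ★ CAYLEY generate the same order.
* §2 (any commutative ring `R`, `σ : R →+* R`, frame `P ∈ GL_n(R)`): `conj_diagonal_one_add_mul_sub_one` (`P·diag(1 + a(x−1))·P⁻¹ = 1 + a•(P·diag x·P⁻¹ − 1)`),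
  `conj_diagonal_inv_mul_conj_diagonal` ∕ `inv_conj_diagonal` (`(P·diag y·P⁻¹)⁻¹ = P·diag y⁻¹·P⁻¹` over a field), and the UNITARY EIGENFRAME:
  **`formCongr_conj_diagonal_eq_of_gram`** — if the Gram matrix `ᵗ(σP)·Φ·P = diag(d)` of the frame is diagonal and `σ(Y_i)·Y_i = 1`, then
  `ᵗσ(P·diag Y·P⁻¹)·Φ·(P·diag Y·P⁻¹) = Φ`, i.e. **`exists_mem_unitaryGroupOfForm_coe_eq_conj_diagonal`**: `P·diag Y·P⁻¹ ∈ U(σ, Φ)` (Flicker's frames `h`,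
  `D_π h` have diagonal Gram matrices ★ `gram_flickerFrame`, `gram_flickerFrame_pi`).
* §3 (a field `K` with `Valued K ℤₘ₀`, `|2| = 1`, an isometric `σ`): `valued_le_exp_neg_one_of_lt_one`, `valued_add_one_eq_one` (`|x − 1| < 1 ⇒ |x + 1| = 1`),
  `valued_shift_le_one`, `valued_shift_cayleyParam_le_one` (`|ϖ⁻¹(x−1)|, |Z| ≤ 1`), **`valued_one_sub_eq_one_and_of_map_eq_neg`** (a SKEW `Z` with `|Z| ≤ 1` has
  `|1 ± Z| = 1` — because `σ(1 − Z) = 1 + Z` and `|2| = 1`), **`valued_cayley_sub_cayley`** (`|Y_i − Y_j| = |x_i − x_j| ∕ |ϖ|`, the `Valued` reading of ★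
  `valuation_cayley_sub_cayley`), `one_le_of_valued_sub_eq_exp_neg` and `exp_neg_div_exp_neg_one` (the exponent bookkeeping `N ↦ N − 1`).

HONEST LABEL: HC_CM is proved only modulo the 2 remaining named inputs (hLiu418 24832, h413 24833) until rung 0 closes; elementary algebra, count-neutral.

## References
* [PlatonovRapinchuk1994] V. Platonov, A. Rapinchuk, *Algebraic Groups and Number Theory* (1994), §2.3 (unitary groups of hermitian forms).
* [SerreLocalFields1979] J.-P. Serre, *Local Fields* (1979), Ch. III §6 (orders), Ch. V §3.
* [Flicker1998UnitaryFL] Y. Z. Flicker, *Elementary proof of the fundamental lemma for a unitary group*, Canad. J. Math. 50 (1998), §1 p. 76, Prop. 3 p. 78 (the frames and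
  their Gram matrices).
* [Rogawski1990] J. D. Rogawski, *Automorphic Representations of Unitary Groups in Three Variables* (1990), §4.9 p. 54 (level structure of the fixed-vertex counts).
-/

set_option autoImplicit false

open Matrix

namespace Literature.NumberTheory.Automorphic

/-! ## §1 Shift-by-one orders: `span_O {(1 + u)^j} = span_O {u^j}` -/

section Span

variable {K : Type*} [Field K] {n : ℕ} (O : Subring K)

/-- `1 + u ∈ O[u]` (the value of the `O`-polynomial `1 + X`). [cite: SerreLocalFields1979, Ch. III §6] -/
theorem one_add_mem_span_pow {u : Fin n → K} (hu : ∀ i, u i ∈ O) :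
    (fun i => 1 + u i) ∈ Submodule.span O (Set.range fun j : Fin n => fun i => u i ^ (j : ℕ)) := by
  have h := eval_mem_span_pow O hu (γ := u) (1 + Polynomial.X)
  simpa only [Polynomial.map_add, Polynomial.map_one, Polynomial.map_X, Polynomial.eval_add, Polynomial.eval_one, Polynomial.eval_X] using h

/-- `u ∈ O[1 + u]` (the value of the `O`-polynomial `X − 1` at `1 + u`). [cite: SerreLocalFields1979, Ch. III §6] -/
theorem self_mem_span_pow_one_add {u : Fin n → K} (hu : ∀ i, u i ∈ O) :
    u ∈ Submodule.span O (Set.range fun j : Fin n => fun i => (1 + u i) ^ (j : ℕ)) := by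
  have h := eval_mem_span_pow O (γ := fun i => 1 + u i) (fun i => O.add_mem O.one_mem (hu i)) (Polynomial.X - 1)
  simp only [Polynomial.map_sub, Polynomial.map_one, Polynomial.map_X, Polynomial.eval_sub, Polynomial.eval_one, Polynomial.eval_X,
    add_sub_cancel_left] at h
  exact h

/-- **`span_O {(1 + u)^j} = span_O {u^j}`** (`u_i ∈ O`): the shifted element `1 + ϖ⁻¹(x − 1)` and the shift `ϖ⁻¹(x − 1)` generate the same order.
[cite: SerreLocalFields1979, Ch. III §6] -/
theorem span_pow_one_add_eq {u : Fin n → K} (hu : ∀ i, u i ∈ O) :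
    Submodule.span O (Set.range fun j : Fin n => fun i => (1 + u i) ^ (j : ℕ)) = Submodule.span O (Set.range fun j : Fin n => fun i => u i ^ (j : ℕ)) :=
  le_antisymm (span_pow_le_span_pow_of_mem O hu (one_add_mem_span_pow O hu))
    (span_pow_le_span_pow_of_mem O (fun i => O.add_mem O.one_mem (hu i)) (self_mem_span_pow_one_add O hu))

end Span

/-! ## §2 The unitary eigenframe: `P·diag(Y)·P⁻¹ ∈ U(σ, Φ)` when the Gram matrix of `P` is diagonal and `σ(Y_i) Y_i = 1` -/

section Frame

variable {R : Type*} [CommRing R] {n : Type*} [Fintype n] [DecidableEq n]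

/-- `P·diag(1 + a(x − 1))·P⁻¹ = 1 + a • (P·diag(x)·P⁻¹ − 1)` (the shifted element in the eigenframe). [cite: SerreLocalFields1979, Ch. III §6] -/
theorem conj_diagonal_one_add_mul_sub_one (P : GL n R) (a : R) (x : n → R) :
    (P : Matrix n n R) * diagonal (fun i => 1 + a * (x i - 1)) * ((P⁻¹ : GL n R) : Matrix n n R) =
      1 + a • ((P : Matrix n n R) * diagonal x * ((P⁻¹ : GL n R) : Matrix n n R) - 1) := by
  have hd : diagonal (fun i => 1 + a * (x i - 1)) = 1 + a • (diagonal x - 1) := by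
    ext i j
    by_cases h : i = j
    · subst h; simp
    · simp [h]
  have hPP : (P : Matrix n n R) * ((P⁻¹ : GL n R) : Matrix n n R) = 1 := by rw [← Units.val_mul, mul_inv_cancel, Units.val_one]
  rw [hd, Matrix.mul_add, Matrix.add_mul, Matrix.mul_one, hPP, Matrix.mul_smul, Matrix.smul_mul, Matrix.mul_sub, Matrix.sub_mul, Matrix.mul_one, hPP]

/-- `(P·diag y⁻¹·P⁻¹) · (P·diag y·P⁻¹) = 1` over a field (`y_i ≠ 0`). [cite: SerreLocalFields1979, Ch. III §6] -/
theorem conj_diagonal_inv_mul_conj_diagonal {K : Type*} [Field K] (P : GL n K) {y : n → K} (hy : ∀ i, y i ≠ 0) :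
    ((P : Matrix n n K) * diagonal y⁻¹ * ((P⁻¹ : GL n K) : Matrix n n K)) * ((P : Matrix n n K) * diagonal y * ((P⁻¹ : GL n K) : Matrix n n K)) = 1 := by
  have h1 : diagonal y⁻¹ * diagonal y = (1 : Matrix n n K) := by
    rw [diagonal_mul_diagonal, ← diagonal_one]
    exact congrArg diagonal (funext fun i => inv_mul_cancel₀ (hy i))
  calc ((P : Matrix n n K) * diagonal y⁻¹ * ((P⁻¹ : GL n K) : Matrix n n K)) * ((P : Matrix n n K) * diagonal y * ((P⁻¹ : GL n K) : Matrix n n K))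
        = (P : Matrix n n K) * (diagonal y⁻¹ * (((P⁻¹ * P : GL n K)) : Matrix n n K) * diagonal y) * ((P⁻¹ : GL n K) : Matrix n n K) := by
          simp only [Matrix.mul_assoc, Units.val_mul]
    _ = 1 := by rw [inv_mul_cancel, Units.val_one, Matrix.mul_one, h1, Matrix.mul_one, ← Units.val_mul, mul_inv_cancel, Units.val_one]

/-- **`(P·diag y·P⁻¹)⁻¹ = P·diag y⁻¹·P⁻¹`** over a field (`y_i ≠ 0`). [cite: SerreLocalFields1979, Ch. III §6] -/
theorem inv_conj_diagonal {K : Type*} [Field K] (P : GL n K) {y : n → K} (hy : ∀ i, y i ≠ 0) :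
    ((P : Matrix n n K) * diagonal y * ((P⁻¹ : GL n K) : Matrix n n K))⁻¹ = (P : Matrix n n K) * diagonal y⁻¹ * ((P⁻¹ : GL n K) : Matrix n n K) :=
  Matrix.inv_eq_left_inv (conj_diagonal_inv_mul_conj_diagonal P hy)

/-- **THE UNITARY EIGENFRAME**: if the Gram matrix of the frame `P` is diagonal, `ᵗ(σP)·Φ·P = diag(d)`, and `σ(Y_i)·Y_i = 1`, then `W = P·diag(Y)·P⁻¹` satisfies
`ᵗ(σW)·Φ·W = Φ` (`ᵗ(σW) Φ W = ᵗσ(P⁻¹)·diag(σY)·diag(d)·diag(Y)·P⁻¹ = ᵗσ(P⁻¹)·diag(d)·P⁻¹ = Φ`). [cite: Flicker1998UnitaryFL, §1 p. 76, Prop. 3 p. 78] [cite: PlatonovRapinchuk1994, §2.3] -/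
theorem formCongr_conj_diagonal_eq_of_gram (σ : R →+* R) (Φ : Matrix n n R) (P : GL n R) {d : n → R}
    (hG : ((P : Matrix n n R).map σ)ᵀ * Φ * (P : Matrix n n R) = diagonal d) {Y : n → R} (hY : ∀ i, σ (Y i) * Y i = 1) :
    (((P : Matrix n n R) * diagonal Y * ((P⁻¹ : GL n R) : Matrix n n R)).map σ)ᵀ * Φ *
        ((P : Matrix n n R) * diagonal Y * ((P⁻¹ : GL n R) : Matrix n n R)) = Φ := by
  have hPP : (P : Matrix n n R) * ((P⁻¹ : GL n R) : Matrix n n R) = 1 := by rw [← Units.val_mul, mul_inv_cancel, Units.val_one]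
  -- `Φ = ᵗσ(P⁻¹) · diag(d) · P⁻¹`
  have hΦ : (((P⁻¹ : GL n R) : Matrix n n R).map σ)ᵀ * diagonal d * ((P⁻¹ : GL n R) : Matrix n n R) = Φ := by
    rw [← hG]
    calc (((P⁻¹ : GL n R) : Matrix n n R).map σ)ᵀ * (((P : Matrix n n R).map σ)ᵀ * Φ * (P : Matrix n n R)) * ((P⁻¹ : GL n R) : Matrix n n R)
          = (((P : Matrix n n R).map σ * ((P⁻¹ : GL n R) : Matrix n n R).map σ))ᵀ * Φ * ((P : Matrix n n R) * ((P⁻¹ : GL n R) : Matrix n n R)) := by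
            rw [transpose_mul]; simp only [Matrix.mul_assoc]
      _ = Φ := by rw [← Matrix.map_mul, hPP, Matrix.map_one σ (map_zero σ) (map_one σ), transpose_one, Matrix.one_mul, Matrix.mul_one]
  -- `diag(σY) · diag(d) · diag(Y) = diag(d)`
  have hD : diagonal (fun i => σ (Y i)) * diagonal d * diagonal Y = diagonal d := by
    rw [diagonal_mul_diagonal, diagonal_mul_diagonal]
    exact congrArg diagonal (funext fun i => by rw [mul_comm (σ (Y i)) (d i), mul_assoc, hY i, mul_one])
  calc (((P : Matrix n n R) * diagonal Y * ((P⁻¹ : GL n R) : Matrix n n R)).map σ)ᵀ * Φ * ((P : Matrix n n R) * diagonal Y * ((P⁻¹ : GL n R) : Matrix n n R))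
        = (((P⁻¹ : GL n R) : Matrix n n R).map σ)ᵀ * (diagonal (fun i => σ (Y i)) * (((P : Matrix n n R).map σ)ᵀ * Φ * (P : Matrix n n R)) * diagonal Y) *
            ((P⁻¹ : GL n R) : Matrix n n R) := by
          rw [Matrix.map_mul, Matrix.map_mul, transpose_mul, transpose_mul, diagonal_map (map_zero σ), diagonal_transpose]
          simp only [Matrix.mul_assoc]
    _ = Φ := by rw [hG, hD, hΦ]

/-- **`P·diag(Y)·P⁻¹ ∈ U(σ, Φ)`** under the same hypotheses (the element of the unitary group with matrix `P·diag(Y)·P⁻¹`; its inverse is `P·diag(σY)·P⁻¹`).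
[cite: Flicker1998UnitaryFL, Prop. 3 p. 78] [cite: PlatonovRapinchuk1994, §2.3] -/
theorem exists_mem_unitaryGroupOfForm_coe_eq_conj_diagonal (σ : R →+* R) (Φ : Matrix n n R) (P : GL n R) {d : n → R}
    (hG : ((P : Matrix n n R).map σ)ᵀ * Φ * (P : Matrix n n R) = diagonal d) {Y : n → R} (hY : ∀ i, σ (Y i) * Y i = 1) :
    ∃ g ∈ unitaryGroupOfForm σ Φ, (g : Matrix n n R) = (P : Matrix n n R) * diagonal Y * ((P⁻¹ : GL n R) : Matrix n n R) := by
  let D : GL n R := ⟨diagonal Y, diagonal fun i => σ (Y i),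
    by rw [diagonal_mul_diagonal, ← diagonal_one]; exact congrArg diagonal (funext fun i => by rw [mul_comm]; exact hY i),
    by rw [diagonal_mul_diagonal, ← diagonal_one]; exact congrArg diagonal (funext fun i => hY i)⟩
  have hval : ((P * D * P⁻¹ : GL n R) : Matrix n n R) = (P : Matrix n n R) * diagonal Y * ((P⁻¹ : GL n R) : Matrix n n R) := by
    rw [Units.val_mul, Units.val_mul]
  refine ⟨P * D * P⁻¹, ?_, hval⟩
  rw [mem_unitaryGroupOfForm_iff, hval]
  exact formCongr_conj_diagonal_eq_of_gram σ Φ P hG hY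

end Frame

/-! ## §3 The `Valued` scalar package of the Cayley shift -/

section ValuedField

variable {K : Type*} [Field K] [Valued K (WithZero (Multiplicative ℤ))]

/-- In the `ℤₘ₀` currency `|x| < 1 ⇒ |x| ≤ exp(−1)`. [cite: SerreLocalFields1979, Ch. V §3] -/
theorem valued_le_exp_neg_one_of_lt_one {x : K} (hx : Valued.v x < 1) : Valued.v x ≤ WithZero.exp (-1 : ℤ) := by
  rw [← WithZero.lt_mul_exp_iff_le WithZero.exp_ne_zero, ← WithZero.exp_add, neg_add_cancel, WithZero.exp_zero]
  exact hx

/-- `|x − 1| < 1` and `|2| = 1` ⇒ `|x + 1| = 1` (`x + 1 = 2 + (x − 1)`). [cite: SerreLocalFields1979, Ch. V §3] -/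
theorem valued_add_one_eq_one (v2 : Valued.v (2 : K) = 1) {x : K} (hx : Valued.v (x - 1) < 1) : Valued.v (x + 1) = 1 := by
  rw [show x + 1 = 2 + (x - 1) by ring, Valuation.map_add_eq_of_lt_left _ (by rwa [v2]), v2]

/-- `|ϖ⁻¹(x − 1)| ≤ 1` for `|x − 1| < 1`, `|ϖ| = exp(−1)`. [cite: SerreLocalFields1979, Ch. V §3] -/
theorem valued_shift_le_one {ϖ : K} (hϖ : Valued.v ϖ = WithZero.exp (-1 : ℤ)) {x : K} (hx : Valued.v (x - 1) < 1) :
    Valued.v (ϖ⁻¹ * (x - 1)) ≤ 1 := by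
  rw [map_mul, map_inv₀, hϖ]
  calc (WithZero.exp (-1 : ℤ))⁻¹ * Valued.v (x - 1) ≤ (WithZero.exp (-1 : ℤ))⁻¹ * WithZero.exp (-1 : ℤ) :=
        mul_le_mul_right (valued_le_exp_neg_one_of_lt_one hx) _
    _ = 1 := inv_mul_cancel₀ WithZero.exp_ne_zero

/-- `|Z| ≤ 1` for the shifted Cayley parameter `Z = ϖ⁻¹(x − 1)(x + 1)⁻¹` (`|x − 1| < 1`, `|2| = 1`, `|ϖ| = exp(−1)`). [cite: SerreLocalFields1979, Ch. V §3] -/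
theorem valued_shift_cayleyParam_le_one (v2 : Valued.v (2 : K) = 1) {ϖ : K} (hϖ : Valued.v ϖ = WithZero.exp (-1 : ℤ)) {x : K}
    (hx : Valued.v (x - 1) < 1) : Valued.v (ϖ⁻¹ * ((x - 1) / (x + 1))) ≤ 1 := by
  rw [← mul_div_assoc, map_div₀, valued_add_one_eq_one v2 hx, div_one]
  exact valued_shift_le_one hϖ hx

/-- **A skew integral element has `|1 ± Z| = 1`**: if `σ` is an isometry, `|2| = 1`, `|Z| ≤ 1` and `σ Z = −Z`, then `|1 − Z| = |1 + Z| = 1` — since `σ(1 − Z) = 1 + Z` and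
`(1 − Z) + (1 + Z) = 2`. [cite: SerreLocalFields1979, Ch. V §3] -/
theorem valued_one_sub_eq_one_and_of_map_eq_neg {σ : K →+* K} (hσv : ∀ x, Valued.v (σ x) = Valued.v x) (v2 : Valued.v (2 : K) = 1)
    {Z : K} (hZ : Valued.v Z ≤ 1) (hσZ : σ Z = -Z) : Valued.v (1 - Z) = 1 ∧ Valued.v (1 + Z) = 1 := by
  have hm1 : Valued.v (1 - Z) ≤ 1 := (Valuation.map_sub _ _ _).trans (max_le (by rw [Valuation.map_one]) hZ)
  have hp1 : Valued.v (1 + Z) ≤ 1 := (Valuation.map_add _ _ _).trans (max_le (by rw [Valuation.map_one]) hZ)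
  have hσm : σ (1 - Z) = 1 + Z := by rw [map_sub, map_one, hσZ, sub_neg_eq_add]
  have hσp : σ (1 + Z) = 1 - Z := by rw [map_add, map_one, hσZ, ← sub_eq_add_neg]
  have key : ∀ {a b : K}, Valued.v a ≤ 1 → Valued.v b = Valued.v a → a + b = 2 → Valued.v a = 1 := by
    intro a b ha hb hab
    by_contra hne
    have hlt : Valued.v a < 1 := lt_of_le_of_ne ha hne
    have h2 : Valued.v (2 : K) < 1 := by
      rw [← hab]
      exact (Valuation.map_add _ _ _).trans_lt (max_lt hlt (hb ▸ hlt))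
    exact absurd v2 h2.ne
  exact ⟨key (b := 1 + Z) hm1 (by rw [← hσm, hσv]) (by ring), key (b := 1 - Z) hp1 (by rw [← hσp, hσv]) (by ring)⟩

/-- **`|Y_i − Y_j| = |x_i − x_j| ∕ |ϖ|`** for the Cayley shifts `Y = (1 + Z)(1 − Z)⁻¹`, `Z = ϖ⁻¹(x − 1)(x + 1)⁻¹` (the `Valued` reading of ★ `valuation_cayley_sub_cayley`): every root
valuation is lowered by one. [cite: SerreLocalFields1979, Ch. V §3] [cite: Rogawski1990, §4.9 p. 54] -/
theorem valued_cayley_sub_cayley (v2 : Valued.v (2 : K) = 1) {ϖ xi xj : K}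
    (hxi : Valued.v (xi + 1) = 1) (hxj : Valued.v (xj + 1) = 1)
    (hZi : Valued.v (1 - ϖ⁻¹ * ((xi - 1) / (xi + 1))) = 1) (hZj : Valued.v (1 - ϖ⁻¹ * ((xj - 1) / (xj + 1))) = 1) :
    Valued.v ((1 + ϖ⁻¹ * ((xi - 1) / (xi + 1))) / (1 - ϖ⁻¹ * ((xi - 1) / (xi + 1))) -
        (1 + ϖ⁻¹ * ((xj - 1) / (xj + 1))) / (1 - ϖ⁻¹ * ((xj - 1) / (xj + 1)))) =
      Valued.v (xi - xj) / Valued.v ϖ := by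
  have hi1 : xi + 1 ≠ 0 := fun h0 => by rw [h0, map_zero] at hxi; exact zero_ne_one hxi
  have hj1 : xj + 1 ≠ 0 := fun h0 => by rw [h0, map_zero] at hxj; exact zero_ne_one hxj
  have hmi : 1 - ϖ⁻¹ * ((xi - 1) / (xi + 1)) ≠ 0 := fun h0 => by rw [h0, map_zero] at hZi; exact zero_ne_one hZi
  have hmj : 1 - ϖ⁻¹ * ((xj - 1) / (xj + 1)) ≠ 0 := fun h0 => by rw [h0, map_zero] at hZj; exact zero_ne_one hZj
  rw [cayley_sub_cayley hmi hmj, ← mul_sub, cayleyParam_sub_cayleyParam hi1 hj1]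
  rw [map_div₀, map_mul, map_mul, map_mul, map_div₀, map_mul, map_mul, map_inv₀, v2, hxi, hxj, hZi, hZj]
  simp [div_eq_mul_inv, mul_comm]

/-- Exponent bookkeeping: two `1`-units at distance `exp(−N)` have `1 ≤ N`. [cite: SerreLocalFields1979, Ch. V §3] -/
theorem one_le_of_valued_sub_eq_exp_neg {xi xj : K} (hxi : Valued.v (xi - 1) < 1) (hxj : Valued.v (xj - 1) < 1) {N : ℕ}
    (hN : Valued.v (xi - xj) = WithZero.exp (-(N : ℤ))) : 1 ≤ N := by
  have h : Valued.v (xi - xj) < 1 := by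
    rw [show xi - xj = (xi - 1) - (xj - 1) by ring]
    exact (Valuation.map_sub _ _ _).trans_lt (max_lt hxi hxj)
  rw [hN, ← WithZero.exp_zero, WithZero.exp_lt_exp] at h
  omega

/-- Exponent bookkeeping: `exp(−N) ∕ exp(−1) = exp(−(N − 1))` for `1 ≤ N`. [cite: SerreLocalFields1979, Ch. V §3] -/
theorem exp_neg_div_exp_neg_one {N : ℕ} (hN : 1 ≤ N) :
    WithZero.exp (-(N : ℤ)) / WithZero.exp (-1 : ℤ) = WithZero.exp (-((N - 1 : ℕ) : ℤ)) := by
  rw [← WithZero.exp_sub, Nat.cast_sub hN]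
  congr 1
  ring

end ValuedField

end Literature.NumberTheory.Automorphic
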